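import Summits.Ventures.HodgeRepro2.T5SU11ResolventOriginBound
import Summits.Ventures.HodgeRepro2.T5SU11KernelDifferenceTwoSidedGlobal

/-!
# Summary XXXIII — the origin bound of the resolvent and the global two-sided `Ξ`-bounds of the composed kernels and of kernel
differences (rows 647–650), under uniform names

Throughout `μ = λ(λ − 2)`, `K_λ` the kernel of `G^I_λ`, `K_λ^{∘(n+1)}(t, s) = (G^I_λ)ⁿ K_λ(·, s)(t)`, `χ_λ` the decaying solution,
`Ξ = φ_1`.

* `resolvent_origin_bound` — **`|G^I_λ g(t)| ≤ Φ ∫ χ_λ |g| sinh 2s ds` for `0 < t ≤ 1`** (row 647);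
* `kernel_comp_two_global`, `kernel_comp_global` — **`|K_λ^{∘2}(t, s)| ≤ C Ξ(t) Ξ(s)` and `|K_λ^{∘(n+2)}(t, s)| ≤ C Ξ(t) Ξ(s)/(λ − 1)^{2n}`
  on all of `(0, ∞)²`** (rows 648–649);
* `kernel_sub_global` — **`|K_λ(t, s) − K_{λ₂}(t, s)| ≤ C Ξ(t) Ξ(s)` on all of `(0, ∞)²` for `|μ − μ₂| < (λ₂ − 1)²`** (row 650).

Nothing is claimed about (N).

Blind lane: Mathlib + the HodgeRepro2 prefix only; no sorry; axioms ⊆ {propext, Classical.choice,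
Quot.sound}.
-/

namespace Summit.Ventures.HodgeRepro2.T5SU11RadialSummaryXXXIII

open Filter Topology MeasureTheory
open Set (Ioi Ioc Icc)
open T5SU11Cartan T5SU11SphericalFunction T5SU11SphericalDecay T5SU11RadialGreenKernel T5SU11RadialGreenImproper
  T5SU11ResolventOriginBound T5SU11KernelCompositionTwoSidedGlobal T5SU11KernelCompositionTwoSidedGlobalAll
  T5SU11KernelDifferenceTwoSidedGlobal

section measure

variable [MeasurableSpace Circle] [BorelSpace Circle]

variable {lam : ℝ} (hlam : 1 < lam)

include hlam in
/-- **The origin bound of the resolvent** (row 647). -/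
theorem resolvent_origin_bound {g : ℝ → ℝ}
    (hB : ∀ T, IntegrableOn (fun s => sph lam (hyp s) * g s * Real.sinh (2 * s)) (Ioc 0 T))
    (hA : IntegrableOn (fun s => sphDecay lam s * g s * Real.sinh (2 * s)) (Ioi 0))
    {Φ : ℝ} (hΦ : ∀ u ∈ Icc (0 : ℝ) 1, sph lam (hyp u) ≤ Φ) {t : ℝ} (ht : 0 < t) (ht1 : t ≤ 1) :
    |greenSolI (fun t => sph lam (hyp t)) (sphDecay lam) g t|
      ≤ Φ * ∫ s in Ioi 0, sphDecay lam s * |g s| * Real.sinh (2 * s) :=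
  abs_greenSolI_le_of_le_one hlam hB hA hΦ ht ht1

include hlam in
/-- **`|K_λ^{∘2}(t, s)| ≤ C Ξ(t) Ξ(s)` on `(0, ∞)²`** (row 648). -/
theorem kernel_comp_two_global :
    ∃ C : ℝ, 0 < C ∧ ∀ t s, 0 < t → 0 < s →
      |((greenSolI (fun t => sph lam (hyp t)) (sphDecay lam))^[1] (fun r => sphGreenKernel lam r s)) t|
        ≤ C * sph 1 (hyp t) * sph 1 (hyp s) :=
  exists_abs_kernel_comp_two_le_mul_sph_one hlam

include hlam in
/-- **`|K_λ^{∘(n+2)}(t, s)| ≤ C Ξ(t) Ξ(s)/(λ − 1)^{2n}` on `(0, ∞)²` for every `n`** (row 649). -/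
theorem kernel_comp_global :
    ∃ C : ℝ, 0 < C ∧ ∀ n : ℕ, ∀ t s, 0 < t → 0 < s →
      |((greenSolI (fun t => sph lam (hyp t)) (sphDecay lam))^[n + 1] (fun u => sphGreenKernel lam u s)) t|
        ≤ C / ((lam - 1) ^ 2) ^ n * sph 1 (hyp t) * sph 1 (hyp s) :=
  exists_abs_kernel_comp_le_mul_sph_one_all hlam

include hlam in
/-- **`|K_λ(t, s) − K_{λ₂}(t, s)| ≤ C Ξ(t) Ξ(s)` on `(0, ∞)²`** for `|μ − μ₂| < (λ₂ − 1)²` (row 650). -/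
theorem kernel_sub_global {lam₂ : ℝ} (hlam₂ : 1 < lam₂) (hq : |lam * (lam - 2) - lam₂ * (lam₂ - 2)| < (lam₂ - 1) ^ 2) :
    ∃ C : ℝ, 0 < C ∧ ∀ t s, 0 < t → 0 < s →
      |sphGreenKernel lam t s - sphGreenKernel lam₂ t s| ≤ C * sph 1 (hyp t) * sph 1 (hyp s) :=
  exists_abs_kernel_sub_le_mul_sph_one hlam hlam₂ hq

end measure

end Summit.Ventures.HodgeRepro2.T5SU11RadialSummaryXXXIII
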